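import Literature.AlgebraicGeometry.Morphisms.SectionConormalChartFinite    -- ★ `ChartRing`, `sectionAug`, `finite_cotangent_sectionAug` (brings `SectionConormalChart`)
import Literature.RingTheory.Smooth.AugmentationIdealCotangentFree         -- ★ (D1a) A-p01 (g22): `free_cotangent_augIdeal`, `finrank_cotangent_augIdeal_eq`, `nonempty_cotangent_augIdeal_linearEquiv_fun`
import Mathlib.AlgebraicGeometry.Morphisms.Smooth
import HarnessLib

/-!
# Over a LOCAL base, the conormal module of a section of a morphism smooth of relative dimension `n` is free of rank `n`, read on a standard-smooth
# affine chart of the section (Görtz–Wedhorn II Prop. 27.15 ∕ Rem. 27.18 (4); EGA IV₄ 17.2.3; Bosch–Lütkebohmert–Raynaud §4.2)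

Topic `Literature/AlgebraicGeometry/Morphisms`, namespace `Literature.AlgebraicGeometry.Morphisms`.  THEOREMS ONLY (no definition, no instance, no notation, no named fact,
no `sorry`).  Sequel of ★ `Morphisms/SectionConormalChart{,Finite}` (the chart ring `ChartRing f W = Γ(X, W)` of an `R`-scheme `f : X → Spec R` as an `R`-algebra, the
augmentation `sectionAug f e he heW : ChartRing f W →ₐ[R] R` of a section `e` landing in `W`, its conormal module `(augIdeal (sectionAug …)).Cotangent = I∕I²`) and of ★
`RingTheory/Smooth/AugmentationIdealCotangentFree` (the algebra: `I∕I²` of an augmentation of a standard-smooth algebra of relative dimension `n` is free of rank `n`).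
Cell `pub/hodgecm-mathlib` (D-0151), programme P6 «MOD», ROW 3 organ **L3.1 «`Lie(A∕S) = (e^*Ω¹_{A∕S})ᵛ`»** (kit author A-p07 (g17), socket `LieRealisation` of `F0/P6-kit/KottwitzCondition.desk`),
brick **(D1b)** of A-p01 (g22)'s census 754bb3cc — the SCHEME half: over a LOCAL ring the unit section of a group scheme smooth of relative dimension `g` has an affine
chart on which `ω = e^*Ω¹ = I∕I²` is free of rank `g`.  HONEST LABEL: HC_CM is proved only modulo the cell's 2 remaining named inputs (hLiu418 24832, h413 24833) until rung 0
closes; this file is unconditional and pays no letter (`--supports stmt-HodgeConjecture-24832`).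

THE MATHEMATICS (`R` LOCAL with closed point `𝔪`, `f : X → Spec R`, `e` a section, `x₀ := e(𝔪)`).  Mathlib's `SmoothOfRelativeDimension n f` hands, at the point `x₀`, affine
opens `U ∋ f(x₀) = 𝔪` of `Spec R` and `W ∋ x₀` of `X` with `Γ(Spec R, U) → Γ(X, W)` STANDARD SMOOTH of relative dimension `n`; an open of `Spec R` containing `𝔪` is everything
(`IsLocalRing.closedPoint_mem_iff`), so `U = ⊤` and `e⁻¹W = ⊤`: the whole section lies in ONE standard-smooth affine chart (§2, `exists_chart_isStandardSmoothOfRelativeDimension`).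
On it the ★ algebra gives `I∕I²` free of rank `n` (§3) — [GortzWedhorn2023] Prop. 27.15 ∕ Rem. 27.18 (4) «`e^*Ω¹_{G∕S}` is locally free of rank `dim`; over a field
(here: a local ring) free», [EGAIV4] (17.2.3).  §1 records, for ANY affine chart, that `Γ(X, W)` is a smooth `R`-algebra when `f` is smooth (Mathlib `Smooth.smooth_appLE`
transported to the `ChartRing` algebra structure), and the transport of `IsStandardSmoothOfRelativeDimension` from Mathlib's `appLE` ring map to `ChartRing`.
* §1 `algebraMap_chartRing_eq`, `smooth_chartRing`, `isStandardSmoothOfRelativeDimension_chartRing_of_appLE`.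
* §2 `base_section_apply` (`f(e(x)) = x`), `preimage_eq_top_of_mem_of_isLocalRing`, **`exists_chart_isStandardSmoothOfRelativeDimension`**.
* §3 **`exists_chart_cotangent_sectionAug_free`** (`∃` affine chart `W ⊇ e(Spec R)` with `I∕I²` free, finite, `finrank = n`, and `≃ₗ[R] (Fin n → R)`), and on a GIVEN
  standard-smooth chart: `free_cotangent_sectionAug_of_isStandardSmooth`, `finrank_cotangent_sectionAug_eq_of_isStandardSmooth`.
NOT here: the `End`-action and the characteristic polynomial (brick (D2) `AbelianSchemes/LieCharpolyLocal`), the abelian-scheme specialisation (one line there: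
`f := 𝒜.X.hom`, `e := η[𝒜.X].left`), charts over a non-local base (★ `AbelianSchemeUnitSectionChart`: after inverting `s`).

## References
* [GortzWedhorn2023] U. Görtz, T. Wedhorn, *Algebraic Geometry II* (2023): Prop. 27.15, Def. 27.17, Rem. 27.18 (1)–(4); (17.3) (conormal sheaf of a section, independence of the chart).
* [EGAIV4] A. Grothendieck, J. Dieudonné, *EGA IV₄*, Publ. Math. IHÉS 32 (1967): (17.2.3)–(17.2.5), (16.9.8).
* [BoschLutkebohmertRaynaud1990] S. Bosch, W. Lütkebohmert, M. Raynaud, *Néron Models* (1990): §4.2 Prop. 2.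
* [StacksProject] The Stacks project: Tag 00T6 (standard smooth), Tag 01V4∕01V9 (smooth morphisms are locally standard smooth).
-/

set_option autoImplicit false

noncomputable section

open CategoryTheory AlgebraicGeometry TopologicalSpace Opposite
open Literature.RingTheory.Smooth

universe u

namespace Literature.AlgebraicGeometry.Morphisms

open ChartRing

variable {R : Type u} [CommRing R] {X : Scheme.{u}} (f : X ⟶ Spec (.of R))

/-! ## §1 Chart rings of a smooth morphism are smooth algebras -/

/-- The structure map of `ChartRing f W` is `f^♯_{⊤ ≤ W} ∘ (R ≅ Γ(Spec R, ⊤))` (unfolding of ★ `ChartRing.instAlgebra`). [cite: GortzWedhorn2023, (17.3)] -/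
theorem algebraMap_chartRing_eq (W : X.Opens) :
    algebraMap R (ChartRing f W) = (mk f W).comp ((f.appLE ⊤ W le_top).hom.comp (Scheme.ΓSpecIso (.of R)).inv.hom) :=
  rfl

/-- **TRANSPORT of a ring-hom property from Mathlib's `f.appLE ⊤ W` to the `R`-algebra `ChartRing f W`**: if `P` respects isomorphisms and holds for
`f^♯ : Γ(Spec R, ⊤) → Γ(X, W)`, it holds for `algebraMap R (ChartRing f W)` (precomposition with the ring isomorphism `R ≅ Γ(Spec R, ⊤)`). [cite: GortzWedhorn2023, (17.3)] -/
theorem ringHomProperty_algebraMap_chartRing {P : ∀ {A B : Type u} [CommRing A] [CommRing B], (A →+* B) → Prop} (hP : RingHom.RespectsIso @P)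
    {W : X.Opens} (h : P (f.appLE ⊤ W le_top).hom) : P (algebraMap R (ChartRing f W)) := by
  rw [algebraMap_chartRing_eq]
  exact hP.2 (f.appLE ⊤ W le_top).hom (Scheme.ΓSpecIso (.of R)).symm.commRingCatIsoToRingEquiv h

/-- **`Γ(X, W)` IS A SMOOTH `R`-ALGEBRA** for `f : X → Spec R` smooth and `W` an affine open (Mathlib `Smooth.smooth_appLE` at `U = ⊤`). [cite: StacksProject, Tag 01V4] -/
theorem smooth_chartRing [Smooth f] {W : X.Opens} (hW : IsAffineOpen W) : Algebra.Smooth R (ChartRing f W) := by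
  have h : (f.appLE ⊤ W le_top).hom.Smooth := Smooth.smooth_appLE f (isAffineOpen_top _) hW (by simp)
  have h' : (algebraMap R (ChartRing f W)).Smooth := ringHomProperty_algebraMap_chartRing f RingHom.Smooth.respectsIso h
  rw [RingHom.Smooth] at h'
  convert h'

/-- `Γ(X, W)` is formally smooth over `R` for `f` smooth, `W` affine. [cite: StacksProject, Tag 01V4] -/
theorem formallySmooth_chartRing [Smooth f] {W : X.Opens} (hW : IsAffineOpen W) : Algebra.FormallySmooth R (ChartRing f W) :=
  haveI := smooth_chartRing f hW
  inferInstance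

/-- **TRANSPORT of standard smoothness**: `Γ(Spec R, ⊤) → Γ(X, W)` standard smooth of relative dimension `n` ⇒ `ChartRing f W` is a standard-smooth `R`-algebra of
relative dimension `n`. [cite: StacksProject, Tag 00T6] -/
theorem isStandardSmoothOfRelativeDimension_chartRing_of_appLE (n : ℕ) {W : X.Opens}
    (h : RingHom.IsStandardSmoothOfRelativeDimension n (f.appLE ⊤ W le_top).hom) :
    Algebra.IsStandardSmoothOfRelativeDimension n R (ChartRing f W) := by
  have h' : RingHom.IsStandardSmoothOfRelativeDimension n (algebraMap R (ChartRing f W)) :=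
    ringHomProperty_algebraMap_chartRing f (RingHom.isStandardSmoothOfRelativeDimension_respectsIso (n := n)) h
  rw [RingHom.IsStandardSmoothOfRelativeDimension] at h'
  convert h'

/-! ## §2 Over a local base: one standard-smooth affine chart contains the whole section -/

section Section

variable (e : Spec (.of R) ⟶ X) (he : e ≫ f = 𝟙 _)

include he in
/-- `f(e(x)) = x` (`e` is a section of `f`). [cite: GortzWedhorn2023, (17.3)] -/
theorem base_section_apply (x : Spec (.of R)) : f.base (e.base x) = x := by
  rw [← Scheme.Hom.comp_apply, he]
  rfl

/-- **Over a LOCAL ring, an open of `X` containing `e(𝔪)` contains the whole section: `e⁻¹V = ⊤`** (an open of `Spec R` containing the closed point is everything,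
Mathlib `IsLocalRing.closedPoint_mem_iff`; same argument as ★ `GroupSchemes.unit_preimage_eq_top`). [cite: GortzWedhorn2023, Rem. 27.18 (4)] -/
theorem preimage_eq_top_of_mem_of_isLocalRing [IsLocalRing R] {V : X.Opens} (hV : e.base (IsLocalRing.closedPoint R) ∈ V) : e ⁻¹ᵁ V = ⊤ :=
  (IsLocalRing.closedPoint_mem_iff _).mp hV

include he in
/-- **A STANDARD-SMOOTH AFFINE CHART OF THE WHOLE SECTION over a local base**: for `f : X → Spec R` smooth of relative dimension `n`, `R` local, and a section `e`,
there is an affine open `W ⊆ X` with `e⁻¹W = ⊤` such that `Γ(X, W)` is a STANDARD-SMOOTH `R`-algebra of relative dimension `n` (Mathlib's local structure of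
`SmoothOfRelativeDimension` at the point `e(𝔪)`; the open `U ∋ 𝔪` of `Spec R` it hands is `⊤`). [cite: StacksProject, Tag 01V9] [cite: GortzWedhorn2023, Rem. 27.18 (4)] -/
theorem exists_chart_isStandardSmoothOfRelativeDimension [IsLocalRing R] (n : ℕ) [SmoothOfRelativeDimension n f] :
    ∃ W : X.Opens, IsAffineOpen W ∧ ∃ _ : e ⁻¹ᵁ W = ⊤, Algebra.IsStandardSmoothOfRelativeDimension n R (ChartRing f W) := by
  obtain ⟨U, hU, V, hV, hx, hle, hstd⟩ :=
    SmoothOfRelativeDimension.exists_isStandardSmoothOfRelativeDimension (n := n) (f := f) (e.base (IsLocalRing.closedPoint R))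
  -- `U ∋ f(e(𝔪)) = 𝔪`, so `U = ⊤`
  have hU' : (IsLocalRing.closedPoint R : ↥(Spec (.of R))) ∈ U := by
    have h1 : f.base (e.base (IsLocalRing.closedPoint R)) ∈ U := hle hx
    rwa [base_section_apply f e he] at h1
  have hUtop : U = ⊤ := (IsLocalRing.closedPoint_mem_iff U).mp hU'
  subst hUtop
  exact ⟨V, hV, preimage_eq_top_of_mem_of_isLocalRing e hx, isStandardSmoothOfRelativeDimension_chartRing_of_appLE f n hstd⟩

/-! ## §3 The conormal module of the section is free of rank `n` -/

variable {W : X.Opens} (heW : e ⁻¹ᵁ W = ⊤)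

/-- On a STANDARD-SMOOTH chart of relative dimension `n` the conormal module `I∕I²` of the section is FREE (★ `free_cotangent_augIdeal`). [cite: GortzWedhorn2023, Prop. 27.15 and Rem. 27.18 (4)] -/
theorem free_cotangent_sectionAug_of_isStandardSmooth (n : ℕ) [Algebra.IsStandardSmoothOfRelativeDimension n R (ChartRing f W)] :
    Module.Free R (augIdeal (sectionAug f e he heW)).Cotangent :=
  free_cotangent_augIdeal (sectionAug f e he heW) n

/-- On a standard-smooth chart `I∕I²` is a finite `R`-module (★ `finite_cotangent_augIdeal_of_isStandardSmooth`; compare ★ `finite_cotangent_sectionAug`, which needs only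
`LocallyOfFinitePresentation f`). [cite: GortzWedhorn2023, Prop. 27.15] -/
theorem finite_cotangent_sectionAug_of_isStandardSmooth (n : ℕ) [Algebra.IsStandardSmoothOfRelativeDimension n R (ChartRing f W)] :
    Module.Finite R (augIdeal (sectionAug f e he heW)).Cotangent :=
  finite_cotangent_augIdeal_of_isStandardSmooth (sectionAug f e he heW) n

/-- On a standard-smooth chart of relative dimension `n`, `rank_R (I∕I²) = n` (`R` nontrivial) (★ `finrank_cotangent_augIdeal_eq`). [cite: GortzWedhorn2023, Prop. 27.15 and Rem. 27.18 (4)] [cite: EGAIV4, (17.2.3)] -/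
theorem finrank_cotangent_sectionAug_eq_of_isStandardSmooth [Nontrivial R] (n : ℕ) [Algebra.IsStandardSmoothOfRelativeDimension n R (ChartRing f W)] :
    Module.finrank R (augIdeal (sectionAug f e he heW)).Cotangent = n :=
  finrank_cotangent_augIdeal_eq (sectionAug f e he heW) n

include he in
/-- **`ω = e^*Ω¹ = I∕I²` IS FREE OF RANK `n` OVER A LOCAL BASE**: for `f : X → Spec R` smooth of relative dimension `n` over a LOCAL ring `R` and a section `e`, there is an
affine chart `W` of the whole section (`e⁻¹W = ⊤`) on which the conormal module `(augIdeal (sectionAug f e he heW)).Cotangent` is free, finite, of `finrank = n`, indeed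
`≃ₗ[R] (Fin n → R)` — the local-base case of «`e^*Ω¹_{X∕S}` is locally free of rank `n`», hence of «`Lie = (e^*Ω¹)ᵛ` is locally free of rank `n`».
[cite: GortzWedhorn2023, Prop. 27.15 and Rem. 27.18 (4)] [cite: EGAIV4, (17.2.3)] [cite: BoschLutkebohmertRaynaud1990, §4.2 Prop. 2] -/
theorem exists_chart_cotangent_sectionAug_free [IsLocalRing R] (n : ℕ) [SmoothOfRelativeDimension n f] :
    ∃ (W : X.Opens) (_ : IsAffineOpen W) (heW : e ⁻¹ᵁ W = ⊤),
      Module.Free R (augIdeal (sectionAug f e he heW)).Cotangent ∧ Module.Finite R (augIdeal (sectionAug f e he heW)).Cotangent ∧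
      Module.finrank R (augIdeal (sectionAug f e he heW)).Cotangent = n ∧ Nonempty ((augIdeal (sectionAug f e he heW)).Cotangent ≃ₗ[R] (Fin n → R)) := by
  obtain ⟨W, hW, heW, hstd⟩ := exists_chart_isStandardSmoothOfRelativeDimension f e he n
  haveI := hstd
  exact ⟨W, hW, heW, free_cotangent_sectionAug_of_isStandardSmooth f e he heW n, finite_cotangent_sectionAug_of_isStandardSmooth f e he heW n,
    finrank_cotangent_sectionAug_eq_of_isStandardSmooth f e he heW n, nonempty_cotangent_augIdeal_linearEquiv_fun (sectionAug f e he heW) n⟩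

end Section

end Literature.AlgebraicGeometry.Morphisms

end
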